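import Summits.BirchSwinnertonDyer.Rank1Residual.Additive.X4ExoticCore
import Summits.BirchSwinnertonDyer.Rank1Residual.GaloisImage.ElkiesModNineImageOfNoTower
import HarnessLib

/-!
# The EXOTIC core of X4 at `3`, CLASS-FREE: `ρ̄_{E,3}` onto ⟹ tower, or additive with the whole core;
# and the junction with Elkies' moduli description (cell `b2b-bsdres`, team n1011, seat p14 gen 4;
# sequel of `Additive/X4ExoticCore.lean`, row T-b11-CORE; consumer of n1011-p10's T-b11-ELK FILE 1d)

HONEST FRAMING (cell `b2b-bsdres`, run/shared/lean/b2b/bsd-rank1-residual/, verbatim in every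
file): the goal of the cell is to DELETE the COMBINATION-SHAPED residual classes of the
Birch–Swinnerton-Dyer formula for ALL analytic-rank `≤ 1` elliptic curves over `ℚ` — "full BSD
formula for every rank `≤ 1` curve in class `C`" assembled STRICTLY from published theorems — so
that the rank-`≤ 1` remainder becomes exactly the CONSTRUCTION-SHAPED classes, which are TYPED
(missing-input `Prop`s), NOT attempted. This is not "finishing BSD". Team n1011 (N10 / N11, the
additive block X4 ∧ `p = 3`): research route; no claim beyond the stated classes; the label X4 is
UNCHANGED by this file; nothing is booked. Theorems only (no definition, no named fact minted; the
one published input of §2 is the explicit named-fact hypothesis `hmod`, never discharged here).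

## What this file proves

* §1 the CLASS-FREE dichotomy **`towerSurj_three_or_exotic_core`**: for EVERY globally minimal
  `E/ℚ` with `ρ̄_{E,3}` onto, either `ρ̄_{E,3ⁿ}` is onto for all `n`, or `E` is additive at `3` and
  carries the whole EXOTIC core (I)–(V) of `ClassX4.exotic_core_of_not_towerSurj_three`
  (semistable at `3`: Wuthrich 2014 Lemma 20, tree theorem; additive: `E[3]` irreducible by
  surjectivity — the frame of n1011-p02's `towerSurj_three_or_exotic_signature`).
* §2 **`exotic_core_iff_j_mem_elkiesJSet_of_surj (hmod)`** — ARITHMETIC CORE ⟺ ELKIES MODULI: with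
  `ρ̄_{E,3}` onto and modulo the one cited moduli sentence
  `Elkies2006.modNineImage_conj_elkiesGroup_iff_j ℚ` (p281678), `E` is additive at `3` with the whole
  core iff `j(E) ∈ f(ℙ¹(ℚ))` (`elkiesJSet ℚ`), by n1011-p10's
  `not_towerSurj_three_iff_j_mem_elkiesJSet_of_surj` (p306334).  n1011-p10's `Additive/X4ExoticIsElkies`
  (p306648) is the X4 end-state form of the same junction and is not restated.

Census reading (EVIDENCE, unchanged): the 20 Elkies cells of the X4-at-3 census (`j ∈ {15786448344,
−44789760, 4374}`) are exactly the tower-less cells; nothing booked; X4 CONSTRUCTION-SHAPED; no label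
change.

References: [Wuthrich2014] Lemma 20 (p. 399); [SerreAbelianLadic1968] IV §3.4 Lemma 3 (IV-23);
[Elkies2006] §§0–3; [SutherlandZywina2017] Prop. 2.7; [Kato2004Asterisque] (12.5.2);
[Sakamoto2024] §2 (H.2); [Maier2006] Table 4.
-/

noncomputable section

open scoped Classical NumberField Pointwise

open Field IsDedekindDomain IsDedekindDomain.HeightOneSpectrum NumberField WeierstrassCurve
  Rat.HeightOneSpectrum
  Literature.NumberTheory.EllipticCurves
  Literature.NumberTheory.EllipticCurves.ModularForms
  Literature.NumberTheory.EllipticCurves.Rank1Residual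
  Literature.NumberTheory.EllipticCurves.Rank1Residual.Typed
  Literature.NumberTheory.GaloisRepresentations Literature.NumberTheory.GaloisCohomology
  Summit.BirchSwinnertonDyer.Rank1Residual.GaloisImage

namespace Summit.BirchSwinnertonDyer.Rank1Residual.Additive

/-! ### §1 The class-free dichotomy: `ρ̄_{E,3}` onto ⟹ tower, or additive at `3` with the whole core -/

section ClassFree

variable {W : WeierstrassCurve ℚ} [W.IsElliptic] [W.IsGloballyMinimal]

/-- **For EVERY globally minimal `E/ℚ` with `ρ̄_{E,3}` onto: either `ρ̄_{E,3ⁿ}` is onto for all `n`,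
or `E` is additive at `3` and carries the whole EXOTIC core (I)–(V) of
`ClassX4.exotic_core_of_not_towerSurj_three` (`Additive/X4ExoticCore`).**  Semistable at `3`:
Wuthrich 2014 Lemma 20 (tree theorem `lemma20_surjective_threeAdic_of_semistable_holds`); additive:
`E[3]` is irreducible by surjectivity, so the pair is X4 at `3` and that theorem applies (the frame
of n1011-p02's `towerSurj_three_or_exotic_signature`). [cite: Wuthrich2014, Lemma 20 (p. 399)]
[cite: SerreAbelianLadic1968, Ch. IV §3.4, Lemma 3 (IV-23)] [cite: Kato2004Asterisque, (12.5.2) in Thm. 12.5 (4) (p. 222)]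
[cite: Sakamoto2024, §2 hypothesis (H.2) (p. 921)] [cite: Maier2006, Table 4 (N = 3, 9) and §5] -/
theorem towerSurj_three_or_exotic_core [Fact (Nat.Prime 3)] (hsurj : Surj W 3) :
    (∀ n : ℕ, W.HasSurjectiveModNGaloisRep (3 ^ n : ℕ)) ∨
    (Addv W 3 ∧
      -- (I) image side
      (¬ W.HasSurjectiveModNGaloisRep 9 ∧ ¬ BigIm W 3 ∧ ¬ Kato2004.ImageContainsSL2 W 3 ∧
        ∀ k : ℕ, 1 ≤ k →
          ¬ ∃ τ : Field.absoluteGaloisGroup ℚ, τ ∈ rootsOfUnityFixer ℚ (3 ^ (k + 1)) ∧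
            Nonempty (cokerSubOne (W.torsionGaloisModule (((3 : ℕ) : ℤ) ^ k * ((3 : ℕ) : ℤ))) τ ≃+
              ZMod (3 ^ (k + 1)))) ∧
      -- (II) local type at `3`
      (SubW W 3 ∧
        (W.kodairaSymbolAt (placeOf 3) = .II ∨ W.kodairaSymbolAt (placeOf 3) = .IV ∨
          W.kodairaSymbolAt (placeOf 3) = .IVstar ∨ W.kodairaSymbolAt (placeOf 3) = .IIstar)) ∧
      -- (III) `j`-adic signature
      (padicValRat 3 (W.j - 1728) = 3 ∧ 3 ≤ padicValRat 3 W.j ∧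
        (∃ (V : ℕ) (c : ℤ), padicValRat 3 W.j = V ∧ (9 : ℤ) ∣ (W.j / 3 ^ V - c).num ∧
          ((V = 3 ∧ c % 9 = 8) ∨
           (6 ≤ V ∧ V % 3 = 0 ∧ (c % 9 = 1 ∨ c % 9 = 8)) ∨
           (V = 7 ∧ (c % 9 = 2 ∨ c % 9 = 4)) ∨
           (8 ≤ V ∧ V % 3 ≠ 0 ∧ (c % 9 = 1 ∨ c % 9 = 8)))) ∧
        ∀ q : ℕ, q.Prime → q ≠ 3 → padicValRat q W.j < 0 → (9 : ℤ) ∣ padicValRat q W.j) ∧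
      -- (IV) wild `3`-torsion at `3`
      (∀ (v : HeightOneSpectrum (𝓞 ℚ)), (primesEquiv v : ℕ) = 3 →
        ∀ (𝔓 : Ideal (absIntegers (𝓞 ℚ) ℚ)),
          (∀ x : absIntegers (𝓞 ℚ) ℚ, x ∈ 𝔓 ↔ (x : AlgebraicClosure ℚ) ∈ (placeOver 3).nonunits) →
          𝔓 ∈ v.primesAbove →
          3 ∣ Nat.card ((𝔓.inertia (absoluteGaloisGroup ℚ)).map (galoisRepTorsion W 3))) ∧
      -- (V) no cube-root digit row, no `c₆`-residue digit row
      ((∀ (n₄ n₆ nΔ : ℕ), padicValRat 3 W.c₄ = n₄ → padicValRat 3 W.c₆ = n₆ →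
          padicValRat 3 W.Δ = nΔ → 2 * n₆ = nΔ + 3 → nΔ + 6 ≤ 3 * n₄ → 3 ∣ n₆ →
          ∀ c : ℚ, ¬ (c ^ 3 * W.Δ / (2 * W.c₆) - 1 = 0 ∨
            (2 : ℤ) ≤ padicValRat 3 (c ^ 3 * W.Δ / (2 * W.c₆) - 1))) ∧
        (∀ (n₄ n₆ nΔ : ℕ), padicValRat 3 W.c₄ = n₄ → padicValRat 3 W.c₆ = n₆ →
          padicValRat 3 W.Δ = nΔ → 2 * n₆ = nΔ + 3 → nΔ + 6 ≤ 3 * n₄ → 3 ∣ n₆ →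
          ∀ s : ℤ, s = 1 ∨ s = -1 →
            ¬ (W.c₆ / 3 ^ n₆ - 2 * s = 0 ∨ (2 : ℤ) ≤ padicValRat 3 (W.c₆ / 3 ^ n₆ - 2 * s))))) := by
  by_cases htower : ∀ n : ℕ, W.HasSurjectiveModNGaloisRep (3 ^ n : ℕ)
  · exact Or.inl htower
  right
  by_cases hadd : Addv W 3
  · haveI : NeZero ((3 : ℕ) : ℚ) := ⟨by norm_num⟩
    have hirr : Irr W 3 := hasIrreducibleModPGaloisRep_of_hasSurjectiveModNGaloisRep W 3 hsurj
    have hX : ClassX4 W 3 := ⟨by decide, hadd, hirr⟩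
    exact ⟨hadd, ClassX4.exotic_core_of_not_towerSurj_three hX hsurj htower⟩
  · exfalso
    have hred : W.HasGoodReductionAtPrime 3 ∨ W.HasMultiplicativeReductionAtPrime 3 := by
      unfold Addv at hadd
      tauto
    exact htower (Wuthrich2014.lemma20_surjective_threeAdic_of_semistable_holds W hred hsurj)

end ClassFree

/-! ### §2 Junction with row T-b11-ELK: the core ⟺ `j ∈ f(ℙ¹(ℚ))`, modulo the one cited moduli sentence -/

section Elkies

variable {W : WeierstrassCurve ℚ} [W.IsElliptic] [W.IsGloballyMinimal]

/-- **ARITHMETIC CORE ⟺ ELKIES MODULI.**  For every globally minimal `E/ℚ` with `ρ̄_{E,3}` onto,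
MODULO the one cited moduli sentence `hmod` ([Elkies2006] §§1–2 with [SutherlandZywina2017] Prop. 2.7,
named fact `Elkies2006.modNineImage_conj_elkiesGroup_iff_j ℚ`, p281678): `E` is additive at `3` and
carries the whole EXOTIC core (I)–(V) of `ClassX4.exotic_core_of_not_towerSurj_three` **iff**
`j(E) ∈ f(ℙ¹(ℚ))`, Elkies' degree-`27` thin set (`elkiesJSet ℚ`).  (⟹: conjunct (I) `ρ̄_{E,9}` not onto kills the tower, then n1011-p10's
`not_towerSurj_three_iff_j_mem_elkiesJSet_of_surj` (T-b11-ELK FILE 1d, p306334); ⟸: the same iff and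
§1.)  So, given `hmod`, every curve over `ℚ` with surjective mod-`3` image and `j ∈ f(ℙ¹(ℚ))` is
additive at `3` of Kodaira type `II/IV/IV*/II*`, with `v₃(j − 1728) = 3`, wild `3`-torsion at `3`, no
Kolyvagin `τ` above level `3`, etc.; n1011-p10's `Additive/X4ExoticIsElkies` (p306648) is the X4
end-state form of the same junction.  Nothing booked. [cite: Elkies2006, §§0–3]
[cite: SutherlandZywina2017, Prop. 2.7] [cite: Wuthrich2014, Lemma 20 (p. 399)]
[cite: SerreAbelianLadic1968, Ch. IV §3.4, Lemma 3 (IV-23)] -/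
theorem exotic_core_iff_j_mem_elkiesJSet_of_surj [Fact (Nat.Prime 3)]
    (hmod : Elkies2006.modNineImage_conj_elkiesGroup_iff_j ℚ) (hsurj : Surj W 3) :
    (Addv W 3 ∧
      -- (I) image side
      (¬ W.HasSurjectiveModNGaloisRep 9 ∧ ¬ BigIm W 3 ∧ ¬ Kato2004.ImageContainsSL2 W 3 ∧
        ∀ k : ℕ, 1 ≤ k →
          ¬ ∃ τ : Field.absoluteGaloisGroup ℚ, τ ∈ rootsOfUnityFixer ℚ (3 ^ (k + 1)) ∧
            Nonempty (cokerSubOne (W.torsionGaloisModule (((3 : ℕ) : ℤ) ^ k * ((3 : ℕ) : ℤ))) τ ≃+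
              ZMod (3 ^ (k + 1)))) ∧
      -- (II) local type at `3`
      (SubW W 3 ∧
        (W.kodairaSymbolAt (placeOf 3) = .II ∨ W.kodairaSymbolAt (placeOf 3) = .IV ∨
          W.kodairaSymbolAt (placeOf 3) = .IVstar ∨ W.kodairaSymbolAt (placeOf 3) = .IIstar)) ∧
      -- (III) `j`-adic signature
      (padicValRat 3 (W.j - 1728) = 3 ∧ 3 ≤ padicValRat 3 W.j ∧
        (∃ (V : ℕ) (c : ℤ), padicValRat 3 W.j = V ∧ (9 : ℤ) ∣ (W.j / 3 ^ V - c).num ∧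
          ((V = 3 ∧ c % 9 = 8) ∨
           (6 ≤ V ∧ V % 3 = 0 ∧ (c % 9 = 1 ∨ c % 9 = 8)) ∨
           (V = 7 ∧ (c % 9 = 2 ∨ c % 9 = 4)) ∨
           (8 ≤ V ∧ V % 3 ≠ 0 ∧ (c % 9 = 1 ∨ c % 9 = 8)))) ∧
        ∀ q : ℕ, q.Prime → q ≠ 3 → padicValRat q W.j < 0 → (9 : ℤ) ∣ padicValRat q W.j) ∧
      -- (IV) wild `3`-torsion at `3`
      (∀ (v : HeightOneSpectrum (𝓞 ℚ)), (primesEquiv v : ℕ) = 3 →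
        ∀ (𝔓 : Ideal (absIntegers (𝓞 ℚ) ℚ)),
          (∀ x : absIntegers (𝓞 ℚ) ℚ, x ∈ 𝔓 ↔ (x : AlgebraicClosure ℚ) ∈ (placeOver 3).nonunits) →
          𝔓 ∈ v.primesAbove →
          3 ∣ Nat.card ((𝔓.inertia (absoluteGaloisGroup ℚ)).map (galoisRepTorsion W 3))) ∧
      -- (V) no cube-root digit row, no `c₆`-residue digit row
      ((∀ (n₄ n₆ nΔ : ℕ), padicValRat 3 W.c₄ = n₄ → padicValRat 3 W.c₆ = n₆ →
          padicValRat 3 W.Δ = nΔ → 2 * n₆ = nΔ + 3 → nΔ + 6 ≤ 3 * n₄ → 3 ∣ n₆ →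
          ∀ c : ℚ, ¬ (c ^ 3 * W.Δ / (2 * W.c₆) - 1 = 0 ∨
            (2 : ℤ) ≤ padicValRat 3 (c ^ 3 * W.Δ / (2 * W.c₆) - 1))) ∧
        (∀ (n₄ n₆ nΔ : ℕ), padicValRat 3 W.c₄ = n₄ → padicValRat 3 W.c₆ = n₆ →
          padicValRat 3 W.Δ = nΔ → 2 * n₆ = nΔ + 3 → nΔ + 6 ≤ 3 * n₄ → 3 ∣ n₆ →
          ∀ s : ℤ, s = 1 ∨ s = -1 →
            ¬ (W.c₆ / 3 ^ n₆ - 2 * s = 0 ∨ (2 : ℤ) ≤ padicValRat 3 (W.c₆ / 3 ^ n₆ - 2 * s))))) ↔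
    W.j ∈ Elkies2006.elkiesJSet ℚ := by
  have key := not_towerSurj_three_iff_j_mem_elkiesJSet_of_surj hmod W hsurj
  constructor
  · rintro ⟨-, hcore⟩
    refine key.mp fun ht ↦ ?_
    have h2 := ht 2
    rw [show ((3 ^ 2 : ℕ) : ℤ) = 9 by norm_num] at h2
    exact hcore.1.1 h2
  · intro hj
    exact (towerSurj_three_or_exotic_core hsurj).resolve_left (key.mpr hj)

end Elkies

end Summit.BirchSwinnertonDyer.Rank1Residual.Additive

end
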